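import Summits.ResolutionOfSingularities.ResolutionOfSingularities.Theorems.FrobeniusLadderFInjectiveMacaulayficationHypersurfaceRegular
import Mathlib.Algebra.MvPolynomial.PDeriv
import Mathlib.Algebra.CharP.Lemmas
import HarnessLib

/-!
# `E₈⁰` in characteristic `5` is regular off the origin

Support file for crux stmt-ResolutionOfSingularities-15315 (`FrobeniusLadder.FInjectiveMacaulayfication`,
line `Sketch`, lead seat c4, cycle 5, wave 3): stub `stub_e8OffCentreRegular` of the §7 CALIBRATION
package (the blow-up `Bl_𝔪 E₈⁰` in characteristic `5`, certified through the blow-up glue E6′).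

Let `k` be a field of characteristic `5`, `S = k[X₀, X₁, X₂]` (`x = X 0`, `y = X 1`, `z = X 2`) and
`R = S/(f)` with `f = X₂² + X₀³ + X₁⁵`, Artin's normal form `E₈⁰` of the rational double point. The
blow-up glue E6′ needs, as its hypothesis `hoff`, that `R` is regular at every prime `P` NOT containing
the irrelevant point `𝔪 = (x̄, ȳ, z̄)`; this file proves exactly that, by the Jacobian criterion in its
regular direction at an arbitrary prime (tree theorem
`HypersurfaceRegular.stub_hypersurfaceRegularOfPderiv`, Matsumura Thm. 30.4 (ii)).

What is proved:

* `pderiv_zero_e8`, `pderiv_two_e8` — `∂f/∂X₀ = 3 X₀²` and `∂f/∂X₂ = 2 X₂` (over any commutative ring).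
* `three_ne_zero_of_charP_five`, `two_ne_zero_of_charP_five` — `3 ≠ 0` and `2 ≠ 0` in a field of
  characteristic `5` (`CharP.cast_eq_zero_iff`).
* `mem_of_C_mul_mem` — an ideal of `k[X]` containing `C c · g` with `c ≠ 0` contains `g` (multiply by
  `C c⁻¹`).
* `stub_e8OffCentreRegular` — the registered form. With `P₀ = P ∩ S ∋ f`: if `X₀ ∉ P₀` then
  `∂f/∂X₀ = 3X₀² ∉ P₀` (`P₀` prime, `3` a unit), so `R_P` is regular by the Jacobian criterion with
  `i = 0`; else if `X₂ ∉ P₀` then `∂f/∂X₂ = 2X₂ ∉ P₀`, Jacobian criterion with `i = 2`; else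
  `X₀, X₂ ∈ P₀` and `f ∈ P₀` give `X₁⁵ ∈ P₀`, hence `X₁ ∈ P₀`, so `𝔪 ≤ P` — excluded by hypothesis.

References: H. Matsumura, *Commutative Ring Theory*, Cambridge Stud. Adv. Math. 8, CUP 1986,
Thm. 30.4 (ii) [Matsumura1987] (through the imported Jacobian criterion); M. Artin, *Coverings of the
rational double points in characteristic `p`*, in: Complex Analysis and Algebraic Geometry, Iwanami
Shoten 1977 [Artin1977] (the form `E₈⁰`, context only). The computation itself is folklore.
-/

-- single-problem summit: the doubled namespace component is forced
set_option linter.dupNamespace false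

noncomputable section

namespace Summit.ResolutionOfSingularities.ResolutionOfSingularities.Theorems.FInjectiveMacaulayfication.E8OffCentreRegular

open MvPolynomial

/-- **`∂f/∂X₀ = 3X₀²`** for `f = X₂² + X₀³ + X₁⁵`, over any commutative ring: `∂X₂/∂X₀ = ∂X₁/∂X₀ = 0`,
`∂X₀³/∂X₀ = 3X₀²` (`MvPolynomial.pderiv_pow`, `pderiv_X_self`, `pderiv_X_of_ne`). [folklore] -/
theorem pderiv_zero_e8 {A : Type*} [CommRing A] :
    pderiv 0 (X 2 ^ 2 + X 0 ^ 3 + X 1 ^ 5 : MvPolynomial (Fin 3) A) = C 3 * X 0 ^ 2 := by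
  simp only [map_add, pderiv_pow, pderiv_X_self, pderiv_X_of_ne (show (2 : Fin 3) ≠ 0 by decide),
    pderiv_X_of_ne (show (1 : Fin 3) ≠ 0 by decide), mul_zero, zero_add, add_zero, mul_one]
  rw [map_ofNat]
  norm_num

/-- **`∂f/∂X₂ = 2X₂`** for `f = X₂² + X₀³ + X₁⁵`, over any commutative ring: `∂X₀/∂X₂ = ∂X₁/∂X₂ = 0`,
`∂X₂²/∂X₂ = 2X₂` (`MvPolynomial.pderiv_pow`, `pderiv_X_self`, `pderiv_X_of_ne`). [folklore] -/
theorem pderiv_two_e8 {A : Type*} [CommRing A] :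
    pderiv 2 (X 2 ^ 2 + X 0 ^ 3 + X 1 ^ 5 : MvPolynomial (Fin 3) A) = C 2 * X 2 := by
  simp only [map_add, pderiv_pow, pderiv_X_self, pderiv_X_of_ne (show (0 : Fin 3) ≠ 2 by decide),
    pderiv_X_of_ne (show (1 : Fin 3) ≠ 2 by decide), mul_zero, add_zero, mul_one]
  rw [map_ofNat]
  norm_num

/-- **`3 ≠ 0` in characteristic `5`**: `(3 : k) = 0` would force `5 ∣ 3` (`CharP.cast_eq_zero_iff`).
[folklore] -/
theorem three_ne_zero_of_charP_five {k : Type*} [Field k] [CharP k 5] : (3 : k) ≠ 0 := by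
  intro h
  have h' : ((3 : ℕ) : k) = 0 := by exact_mod_cast h
  rw [CharP.cast_eq_zero_iff k 5 3] at h'
  omega

/-- **`2 ≠ 0` in characteristic `5`**: `(2 : k) = 0` would force `5 ∣ 2` (`CharP.cast_eq_zero_iff`).
[folklore] -/
theorem two_ne_zero_of_charP_five {k : Type*} [Field k] [CharP k 5] : (2 : k) ≠ 0 := by
  intro h
  have h' : ((2 : ℕ) : k) = 0 := by exact_mod_cast h
  rw [CharP.cast_eq_zero_iff k 5 2] at h'
  omega

/-- **Non-zero constants are cancellable modulo any ideal of `k[X]`**: if `C c · g ∈ P` with `c ≠ 0` in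
the field `k`, then `g = C c⁻¹ · (C c · g) ∈ P`. [folklore] -/
theorem mem_of_C_mul_mem {k : Type*} [Field k] {n : ℕ} (P : Ideal (MvPolynomial (Fin n) k))
    {c : k} (hc : c ≠ 0) {g : MvPolynomial (Fin n) k} (h : C c * g ∈ P) : g ∈ P := by
  have h2 := P.mul_mem_left (C c⁻¹) h
  rwa [← mul_assoc, ← map_mul, inv_mul_cancel₀ hc, map_one, one_mul] at h2

/-- **`E₈⁰` in characteristic `5` is regular off the origin** (registered stub
`stub_e8OffCentreRegular` of the §7 calibration package): for a field `k` of characteristic `5`,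
`f = X₂² + X₀³ + X₁⁵ ∈ S = k[X₀,X₁,X₂]`, `R = S/(f)`, and a prime `P` of `R` not containing
`𝔪 = (x̄, ȳ, z̄)`, the local ring `R_P` is regular. Proof: let `P₀ = P ∩ S`, a prime containing `f`.
If `X₀ ∉ P₀`, then `∂f/∂X₀ = 3X₀² ∉ P₀` (`3` is a unit, `P₀` is prime), and the Jacobian criterion
(`HypersurfaceRegular.stub_hypersurfaceRegularOfPderiv`, `i = 0`) applies; if `X₂ ∉ P₀`, then
`∂f/∂X₂ = 2X₂ ∉ P₀` and the criterion applies with `i = 2`; otherwise `X₀, X₂, f ∈ P₀` give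
`X₁⁵ = f - X₂² - X₀³ ∈ P₀`, so `X₁ ∈ P₀` and `𝔪 ≤ P`, contradicting the hypothesis. [folklore] -/
theorem stub_e8OffCentreRegular : ∀ (k : Type) [Field k] [CharP k 5] (f : MvPolynomial (Fin 3) k),
    f = MvPolynomial.X 2 ^ 2 + MvPolynomial.X 0 ^ 3 + MvPolynomial.X 1 ^ 5 →
    ∀ (P : Ideal (MvPolynomial (Fin 3) k ⧸ Ideal.span {f})) [P.IsPrime],
      ¬ Ideal.span (Set.range fun j : Fin 3 => Ideal.Quotient.mk (Ideal.span {f}) (MvPolynomial.X j)) ≤ P →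
      IsRegularLocalRing (Localization.AtPrime P) := by
  intro k _ _ f hf P _ hP
  haveI hprime : (P.comap (Ideal.Quotient.mk (Ideal.span {f}))).IsPrime := Ideal.comap_isPrime _ _
  have hfP : f ∈ P.comap (Ideal.Quotient.mk (Ideal.span {f})) := by
    rw [Ideal.mem_comap, Ideal.Quotient.eq_zero_iff_mem.mpr (Ideal.mem_span_singleton_self f)]
    exact P.zero_mem
  by_cases h0 : (X 0 : MvPolynomial (Fin 3) k) ∈ P.comap (Ideal.Quotient.mk (Ideal.span {f}))
  · by_cases h2 : (X 2 : MvPolynomial (Fin 3) k) ∈ P.comap (Ideal.Quotient.mk (Ideal.span {f}))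
    · -- `X₀, X₂ ∈ P₀`: then `X₁ ∈ P₀` too, so `𝔪 ≤ P`, excluded
      exfalso
      refine hP ?_
      have h1 : (X 1 : MvPolynomial (Fin 3) k) ∈ P.comap (Ideal.Quotient.mk (Ideal.span {f})) := by
        refine hprime.mem_of_pow_mem 5 ?_
        have e : (X 1 ^ 5 : MvPolynomial (Fin 3) k) = f - X 2 ^ 2 - X 0 ^ 3 := by
          rw [hf]; ring
        rw [e]
        exact Ideal.sub_mem _ (Ideal.sub_mem _ hfP (Ideal.pow_mem_of_mem _ h2 2 two_pos))
          (Ideal.pow_mem_of_mem _ h0 3 three_pos)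
      rw [Ideal.span_le, Set.range_subset_iff]
      intro j
      fin_cases j
      exacts [h0, h1, h2]
    · -- `X₂ ∉ P₀`: Jacobian criterion with `∂f/∂X₂ = 2X₂ ∉ P₀`
      refine HypersurfaceRegular.stub_hypersurfaceRegularOfPderiv k 3 f 2 P (fun hd => h2 ?_)
      have e : pderiv 2 f = C 2 * X 2 := by rw [hf]; exact pderiv_two_e8
      rw [e] at hd
      exact mem_of_C_mul_mem _ two_ne_zero_of_charP_five hd
  · -- `X₀ ∉ P₀`: Jacobian criterion with `∂f/∂X₀ = 3X₀² ∉ P₀`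
    refine HypersurfaceRegular.stub_hypersurfaceRegularOfPderiv k 3 f 0 P (fun hd => h0 ?_)
    have e : pderiv 0 f = C 3 * X 0 ^ 2 := by rw [hf]; exact pderiv_zero_e8
    rw [e] at hd
    exact hprime.mem_of_pow_mem 2 (mem_of_C_mul_mem _ three_ne_zero_of_charP_five hd)

end Summit.ResolutionOfSingularities.ResolutionOfSingularities.Theorems.FInjectiveMacaulayfication.E8OffCentreRegular

end
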